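import Literature.NumberTheory.EllipticCurves.TunnellWeightThreeHalvesBasisProofs
import HarnessLib

/-!
# Weight-`3/2` cusp forms of level `128` and trivial character are supported on odd exponents

[[cite: Tunnell1983Congruent, p. 327 ("a basis … is `{g θ₂, g θ₈, g θ₃₂}`")]] — a consequence of
the tree's spanning theorem `halfIntCuspForms_three_le_span_triv`
(`S_{3/2}(128, 1) ⊆ span {g θ₂, g θ₈, g θ₃₂}`): the exponents `(4m+1)² + 8n² + t k²` of `g θ_t`,
`t ∈ {2, 8, 32}`, are all ODD, so **every `f ∈ S_{3/2}(128, 1)` has `a_f(n) = 0` for even `n`**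
(`qCoeffs_eq_zero_of_even_of_mem_halfIntCuspForms`).

Recorded because it is the obstruction to an elementary "symmetric family + diagonal" proof of
Waldspurger's corollary at level `128` through Shintani lifts on the level-`32` lattice
`L₃₂ = {[32a, b, c]}` (`Shintani32Kernel` … `Shintani32LiftQExpansion`): there the split orbits —
the only ones whose coefficients are modular symbols, hence central `L`-values — sit at the even
indices `n = 2Dm²` (`Δ = 128 · n₃₂`), where this theorem makes every lift coefficient vanish.

No named facts, no definitions.
-/

noncomputable section

open UpperHalfPlane hiding I

namespace Literature.NumberTheory.EllipticCurves.Tunnell1983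

open Literature.NumberTheory.EllipticCurves.ModularForms

/-- The `q`-coefficients of `g θ_t`, `t ∈ {2, 8, 32}`, vanish at even exponents. [folklore] -/
theorem qCoeffs_tunnellForm_eq_zero_of_even {t : ℕ} (ht : t = 2 ∨ t = 8 ∨ t = 32) {n : ℕ}
    (hn : Even n) : qCoeffs (tunnellForm t) n = 0 := by
  obtain ⟨r, hr⟩ := hn
  have h8 : n % 8 ≠ 1 ∧ n % 8 ≠ 3 := by omega
  rcases ht with rfl | rfl | rfl
  · rw [qCoeffs_tunnellForm (by norm_num : 0 < 2)]
    dsimp only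
    rw [formCoeff_two_eq_zero h8, Int.cast_zero]
  · rw [qCoeffs_tunnellForm (by norm_num : 0 < 8)]
    dsimp only
    rw [formCoeff_eight_eq_zero h8.1, Int.cast_zero]
  · rw [qCoeffs_tunnellForm (by norm_num : 0 < 32)]
    dsimp only
    rw [formCoeff_thirtyTwo_eq_zero h8.1, Int.cast_zero]

/-- **Every weight-`3/2` cusp form of level `128` and trivial character is supported on odd
exponents**: `a_f(n) = 0` for `n` even. [cite: Tunnell1983Congruent, p. 327] -/
theorem qCoeffs_eq_zero_of_even_of_mem_halfIntCuspForms {f : ℍ → ℂ}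
    (hf : f ∈ halfIntCuspForms 3 128 1) {n : ℕ} (hn : Even n) : qCoeffs f n = 0 := by
  have hM := halfIntCuspForms_le_halfIntModularForms 3 128 (1 : DirichletCharacter ℂ 128)
  have h2 := hM tunnellForm_two_mem_halfIntCuspForms
  have h8 := hM tunnellForm_eight_mem_halfIntCuspForms
  have h32 := hM tunnellForm_thirtytwo_mem_halfIntCuspForms
  have hspan := halfIntCuspForms_three_le_span_triv hf
  rw [Submodule.mem_span_insert] at hspan
  obtain ⟨a, g, hg, rfl⟩ := hspan
  rw [Submodule.mem_span_pair] at hg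
  obtain ⟨b, c, rfl⟩ := hg
  have hg8 : b • tunnellForm 8 ∈ halfIntModularForms 3 128 1 := Submodule.smul_mem _ _ h8
  have hg32 : c • tunnellForm 32 ∈ halfIntModularForms 3 128 1 := Submodule.smul_mem _ _ h32
  rw [qCoeffs_add (Submodule.smul_mem _ _ h2) (Submodule.add_mem _ hg8 hg32), qCoeffs_add hg8 hg32,
    qCoeffs_smul h2, qCoeffs_smul h8, qCoeffs_smul h32]
  simp only [Pi.add_apply, Pi.smul_apply, smul_eq_mul]
  rw [qCoeffs_tunnellForm_eq_zero_of_even (Or.inl rfl) hn,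
    qCoeffs_tunnellForm_eq_zero_of_even (Or.inr (Or.inl rfl)) hn,
    qCoeffs_tunnellForm_eq_zero_of_even (Or.inr (Or.inr rfl)) hn]
  ring

end Literature.NumberTheory.EllipticCurves.Tunnell1983
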